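import Literature.MathematicalPhysics.QuantumFieldTheory.MullerSchiemann1987.MS87NonperturbativeBound
import HarnessLib

/-!
# Müller–Schiemann, *Continuum limit of a hierarchical SU(2) lattice gauge theory in 4 dimensions*
# (CMP 110, 1987), (5.5) p.276 — THE NORMALISATION `M = ∫dv[g(v)]²` OF (5.3) IS OF ORDER `β^{−3/2}`, LOWER HALF:
# `M ≥ m·β^{−3/2}` with an explicit `m`, from the small-field assumption (A₃) on the group and Weyl's integration
# formula — PROVED (theorems only; no definition, no named fact)

statement-level skeleton of published theorems with citation tags; proofs where landed; nothing here is a claim about the Yang–Mills mass gap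

[MullerSchiemann1987] V. F. Müller, J. Schiemann, Commun. Math. Phys. **110** (1987) 261–286, Sect. 5 p.275 (5.3) and
p.276 (5.5); Sect. 3 p.267 (A₃); Sect. 2 p.264 (2.16)–(2.17) (a class function is a function of the central angle).
Read by this seat on its own 3× page renders of the journal scan (`renders-cmp110ms/`, PDF page = journal page − 260:
p.275 = PDF 15, p.276 = PDF 16, p.267 = PDF 7). Lean lane of the lit-balaban YM LIT SWEEP CONTEXT row X1 (register
`MullerSchiemann1987/`); the model is the `d = 4` HIERARCHICAL `SU(2)` gauge model (Migdal's recursion), NOT lattice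
Yang–Mills. Sibling of `MS87NonperturbativeBound`, whose (5.24) ⟹ (5.25) step (`eq525`) consumes (5.5) «only through
`M ≥ mβ^{−3/2}`» as a hypothesis, and of `MS87SmallFieldInputs` ((4.53) from (A₃): `|h(θ)| ≥ exp{−βRe θ² − C}`).
THIS FILE DISCHARGES THAT HYPOTHESIS: the lower half of (5.5) from (A₃) on the group.

**What the paper prints.** (5.3) p.275: *«M = ∫dv[g(v)]².»* (5.5) p.276: *«From the assumptions (A₂) and (A₃) we can
easily deduce M = const β^{−3/2}{1 + 𝒪(β^{1−4α})}.»* (A₃) p.267: *«In the domain z ∈ ℂ, |z| < β^{−α}, there exists a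
holomorphic function V(z) such that h(z) = exp{−V(z)}, V(z) = βz² + ½λz⁴ + ⅓σz⁶ + Ṽ(z) … |β^{−1}λ|, |β^{−1}σ| are bounded
by constants. Moreover the bound |Ṽ(z)| < Dβ^{−2} holds in the domain, with a constant D.»* (so on the group, where
`g(v) = h(θ(v))` by (2.16), `g(v) ≥ exp{−βθ(v)² − C}` for `θ(v) < β^{−α}`, `C = (½c_λ + ⅓c_σ)β^{1−4α} + Dβ^{−2}` — the
sibling's `SmallFieldInputs.eq453_norm_ge`).

**What this file proves (kernel-checked, 0 sorry, standard axioms; theorems only, no definition, no named fact).**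
For ANY continuous `g : SU(2) → ℝ` with the small-field lower bound `g(v) ≥ exp{−βθ(v)² − C}` whenever the central
angle `θ(v) = centralAngle v < ϱ`, and `β ≥ 1`, `β^{−1/2} ≤ ϱ` (for `ϱ = β^{−α}`, `α ≤ ½`, automatic):
**`M = ∫dv g(v)² ≥ (e^{−2−2C}/(3π³))·β^{−3/2}`** (`M_lower_bound`). Route: Weyl's integration formula for class functions
of `SU(2)` (the sibling's `NonperturbativeBound.integral_comp_u0`: `∫F(v₀)dv = (2/π)∫₀^π F(cos θ)sin²θ dθ`) applied to a
continuous cut-off minorant `ψ(v₀) ≤ g(v)²` supported in `θ(v) < r := β^{−1/2}` (where `βθ² ≤ 1`, so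
`g² ≥ e^{−2−2C}`) and equal to `e^{−2−2C}` on `θ(v) ≤ r/2`; then Jordan's inequality `sin θ ≥ (2/π)θ` and
`∫₀^{r/2}θ²dθ = r³/24` give `(2/π)·e^{−2−2C}·(4/π²)·r³/24 = e^{−2−2C}r³/(3π³)`. Also: the same bound stated with
`ϱ = β^{−α}` (`M_lower_bound_rpow`).

**Readings / scope (declared).** (i) Only the LOWER half of (5.5) (the half the sibling uses); the upper half and the
`{1 + 𝒪(β^{1−4α})}` refinement need (A₂) and a Laplace-type asymptotic and are not formalised. (ii) `g` is a letter with
(A₁)'s continuity and (A₃)'s consequence on the group as hypotheses, exactly as in the siblings; the constant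
`m = e^{−2−2C}/(3π³)` is crude, not the print's «const». (iii) `dv` is the normalised Haar measure `haarProbability`.

**Not claimed.** (5.5) as an asymptotic equality, (A₂), (A₃) themselves, Theorem 1, anything about lattice Yang–Mills or
the Clay problem.
-/

open MeasureTheory intervalIntegral Set

namespace Literature.MathematicalPhysics.QuantumFieldTheory

namespace MullerSchiemann1987

namespace MLowerBound

open Literature.MathematicalPhysics.QuantumFieldTheory (haarProbability)
open HeatKernel (u0 continuous_u0 abs_u0_le_one centralAngle centralAngle_eq_arccos_u0)
open NonperturbativeBound (integral_comp_u0)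

/-- A continuous function on `SU(2)` is integrable for the Haar probability measure. [folklore] -/
private theorem integrable_of_continuous {f : Matrix.specialUnitaryGroup (Fin 2) ℂ → ℝ} (hf : Continuous f) :
    Integrable f (haarProbability (Matrix.specialUnitaryGroup (Fin 2) ℂ)) :=
  hf.integrable_of_hasCompactSupport (HasCompactSupport.of_compactSpace _)

/-- The piecewise-linear cut-off `κ(c) = max(0, min(1, (c − a)/(b − a)))`: continuous, `0 ≤ κ ≤ 1`, `κ(c) = 0` for
`c ≤ a`, `κ(c) = 1` for `c ≥ b` (`a < b`). [folklore] -/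
private theorem cutoff_props {a b : ℝ} (hab : a < b) :
    Continuous (fun c : ℝ => max 0 (min 1 ((c - a) / (b - a)))) ∧
      (∀ c, 0 ≤ max 0 (min 1 ((c - a) / (b - a)))) ∧ (∀ c, max 0 (min 1 ((c - a) / (b - a))) ≤ 1) ∧
      (∀ c, c ≤ a → max 0 (min 1 ((c - a) / (b - a))) = 0) ∧ (∀ c, b ≤ c → max 0 (min 1 ((c - a) / (b - a))) = 1) := by
  have hba : 0 < b - a := by linarith
  refine ⟨?_, fun c => le_max_left _ _, fun c => max_le zero_le_one (min_le_left _ _), ?_, ?_⟩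
  · exact continuous_const.max (continuous_const.min ((continuous_id.sub continuous_const).div_const _))
  · intro c hc
    have : (c - a) / (b - a) ≤ 0 := div_nonpos_of_nonpos_of_nonneg (by linarith) hba.le
    rw [max_eq_left]
    exact (min_le_right _ _).trans this
  · intro c hc
    have : 1 ≤ (c - a) / (b - a) := by rw [le_div_iff₀ hba]; linarith
    rw [min_eq_left this, max_eq_right zero_le_one]

/-- `∫₀^s θ² dθ = s³/3`. [folklore] -/
private theorem integral_sq (s : ℝ) : ∫ θ in (0:ℝ)..s, θ ^ 2 = s ^ 3 / 3 := by
  rw [integral_pow]; norm_num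

/-- **(5.5), LOWER HALF: `M = ∫dv g(v)² ≥ (e^{−2−2C}/(3π³))·β^{−3/2}`** for any continuous `g` on `SU(2)` with the
small-field lower bound `g(v) ≥ exp{−βθ(v)² − C}` for `θ(v) < ϱ` ((A₃) on the group via (2.16), cf. the sibling's
`SmallFieldInputs.eq453_norm_ge`), `β ≥ 1`, `β^{−1/2} ≤ ϱ`. («From the assumptions (A₂) and (A₃) we can easily deduce
M = const β^{−3/2}{1 + 𝒪(β^{1−4α})}» — the half used in (5.25).) [cite: MullerSchiemann1987, (5.5) p.276; (5.3) p.275; (A₃) p.267] -/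
theorem M_lower_bound {g : Matrix.specialUnitaryGroup (Fin 2) ℂ → ℝ} {β ρ C : ℝ} (hg : Continuous g) (hβ : 1 ≤ β)
    (hρ : β ^ (-(1 / 2 : ℝ)) ≤ ρ)
    (hA3 : ∀ v : Matrix.specialUnitaryGroup (Fin 2) ℂ, centralAngle v < ρ →
      Real.exp (-(β * centralAngle v ^ 2) - C) ≤ g v) :
    Real.exp (-2 - 2 * C) / (3 * Real.pi ^ 3) * β ^ (-(3 / 2 : ℝ)) ≤
      ∫ v, g v ^ 2 ∂(haarProbability (Matrix.specialUnitaryGroup (Fin 2) ℂ)) := by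
  have hβ0 : 0 < β := by linarith
  have hπ := Real.pi_pos
  have hπ3 := Real.pi_gt_three
  -- the scale `r = β^{−1/2}`: `βr² = 1`, `r³ = β^{−3/2}`, `0 < r ≤ 1 < π`
  set r := β ^ (-(1 / 2 : ℝ)) with hr
  have hr0 : 0 < r := Real.rpow_pos_of_pos hβ0 _
  have hr1 : r ≤ 1 := Real.rpow_le_one_of_one_le_of_nonpos hβ (by norm_num)
  have hβr : β * r ^ 2 = 1 := by
    rw [hr, ← Real.rpow_natCast, ← Real.rpow_mul hβ0.le]; norm_num
    rw [Real.rpow_neg hβ0.le, Real.rpow_one, mul_inv_cancel₀ hβ0.ne']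
  have hr3 : r ^ 3 = β ^ (-(3 / 2 : ℝ)) := by
    rw [hr, ← Real.rpow_natCast, ← Real.rpow_mul hβ0.le]; norm_num
  have hrπ : r < Real.pi := by linarith
  -- the cut-off in the variable `c = v₀ = cos θ(v)`: `a = cos r < b = cos(r/2)`
  have hab : Real.cos r < Real.cos (r / 2) :=
    Real.cos_lt_cos_of_nonneg_of_le_pi (by linarith) hrπ.le (by linarith)
  obtain ⟨hκc, hκ0, hκ1, hκzero, hκone⟩ := cutoff_props hab
  set κ : ℝ → ℝ := fun c => max 0 (min 1 ((c - Real.cos r) / (Real.cos (r / 2) - Real.cos r))) with hκ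
  set ψ : ℝ → ℝ := fun c => Real.exp (-2 - 2 * C) * κ c with hψ
  have hψc : Continuous ψ := continuous_const.mul hκc
  have hE0 : 0 < Real.exp (-2 - 2 * C) := Real.exp_pos _
  -- pointwise: `ψ(v₀) ≤ g(v)²`
  have hpt : ∀ v : Matrix.specialUnitaryGroup (Fin 2) ℂ, ψ (u0 v) ≤ g v ^ 2 := by
    intro v
    have hu := abs_le.mp (abs_u0_le_one v)
    rcases le_or_gt (u0 v) (Real.cos r) with hle | hle
    · have : ψ (u0 v) = 0 := by simp only [hψ, hκ, hκzero _ hle, mul_zero]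
      rw [this]; exact sq_nonneg _
    · -- `θ(v) = arccos v₀ < arccos(cos r) = r ≤ ϱ`, so (A₃) applies and `βθ(v)² ≤ βr² = 1`
      have hθ : centralAngle v < r := by
        rw [centralAngle_eq_arccos_u0]
        calc Real.arccos (u0 v) < Real.arccos (Real.cos r) :=
              Real.arccos_lt_arccos (Real.neg_one_le_cos r) hle hu.2
          _ = r := Real.arccos_cos hr0.le hrπ.le
      have hθ0 : 0 ≤ centralAngle v := by rw [centralAngle_eq_arccos_u0]; exact Real.arccos_nonneg _
      have h1 := hA3 v (lt_of_lt_of_le hθ hρ)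
      have hθ2 : β * centralAngle v ^ 2 ≤ 1 := by
        have := pow_le_pow_left₀ hθ0 hθ.le 2
        have := mul_le_mul_of_nonneg_left this hβ0.le
        linarith
      have h2 : Real.exp (-1 - C) ≤ g v :=
        (Real.exp_le_exp.mpr (by linarith)).trans h1
      have h3 : Real.exp (-1 - C) ^ 2 ≤ g v ^ 2 := pow_le_pow_left₀ (Real.exp_pos _).le h2 2
      have h4 : Real.exp (-1 - C) ^ 2 = Real.exp (-2 - 2 * C) := by
        rw [sq, ← Real.exp_add]; ring_nf
      calc ψ (u0 v) = Real.exp (-2 - 2 * C) * κ (u0 v) := rfl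
        _ ≤ Real.exp (-2 - 2 * C) * 1 := mul_le_mul_of_nonneg_left (hκ1 _) hE0.le
        _ ≤ g v ^ 2 := by rw [mul_one, ← h4]; exact h3
  -- integrate and apply Weyl's formula
  have hint : ∫ v, ψ (u0 v) ∂(haarProbability (Matrix.specialUnitaryGroup (Fin 2) ℂ)) ≤
      ∫ v, g v ^ 2 ∂(haarProbability (Matrix.specialUnitaryGroup (Fin 2) ℂ)) :=
    integral_mono (integrable_of_continuous (hψc.comp continuous_u0)) (integrable_of_continuous (hg.pow 2)) hpt
  rw [integral_comp_u0 ψ hψc] at hint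
  -- the interval integral: split at `r/2`, drop `[r/2, π]`, and use `κ(cos θ) = 1`, `sin θ ≥ (2/π)θ` on `[0, r/2]`
  set F : ℝ → ℝ := fun θ => Real.sin θ ^ 2 * ψ (Real.cos θ) with hF
  have hFc : Continuous F := (Real.continuous_sin.pow 2).mul (hψc.comp Real.continuous_cos)
  have hF0 : ∀ θ, 0 ≤ F θ := fun θ => mul_nonneg (sq_nonneg _) (mul_nonneg hE0.le (hκ0 _))
  have hsplit : ∫ θ in (0:ℝ)..Real.pi, F θ = (∫ θ in (0:ℝ)..r / 2, F θ) + ∫ θ in r / 2..Real.pi, F θ :=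
    (intervalIntegral.integral_add_adjacent_intervals (hFc.intervalIntegrable (μ := volume) _ _)
      (hFc.intervalIntegrable (μ := volume) _ _)).symm
  have htail : 0 ≤ ∫ θ in r / 2..Real.pi, F θ :=
    intervalIntegral.integral_nonneg (by linarith) fun θ _ => hF0 θ
  have hhead : Real.exp (-2 - 2 * C) * (4 / Real.pi ^ 2) * ((r / 2) ^ 3 / 3) ≤ ∫ θ in (0:ℝ)..r / 2, F θ := by
    have hmono : ∫ θ in (0:ℝ)..r / 2, Real.exp (-2 - 2 * C) * (4 / Real.pi ^ 2) * θ ^ 2 ≤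
        ∫ θ in (0:ℝ)..r / 2, F θ := by
      refine intervalIntegral.integral_mono_on (by linarith)
        ((continuous_const.mul (continuous_pow 2)).intervalIntegrable (μ := volume) _ _)
        (hFc.intervalIntegrable (μ := volume) _ _) fun θ hθ => ?_
      obtain ⟨hθ0, hθr⟩ := hθ
      -- `κ(cos θ) = 1` since `cos θ ≥ cos(r/2)`
      have hcos : Real.cos (r / 2) ≤ Real.cos θ :=
        Real.cos_le_cos_of_nonneg_of_le_pi hθ0 (by linarith) hθr
      have hψ1 : ψ (Real.cos θ) = Real.exp (-2 - 2 * C) := by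
        simp only [hψ, hκ, hκone _ hcos, mul_one]
      -- Jordan: `sin θ ≥ (2/π)θ` on `[0, π/2]`
      have hj := Real.mul_le_sin hθ0 (by linarith)
      have hj0 : 0 ≤ 2 / Real.pi * θ := by positivity
      have hsq : (2 / Real.pi * θ) ^ 2 ≤ Real.sin θ ^ 2 := pow_le_pow_left₀ hj0 hj 2
      calc Real.exp (-2 - 2 * C) * (4 / Real.pi ^ 2) * θ ^ 2 = (2 / Real.pi * θ) ^ 2 * Real.exp (-2 - 2 * C) := by
            ring
        _ ≤ Real.sin θ ^ 2 * Real.exp (-2 - 2 * C) := mul_le_mul_of_nonneg_right hsq hE0.le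
        _ = F θ := by rw [hF]; simp only [hψ1]
    rw [intervalIntegral.integral_const_mul, integral_sq] at hmono
    exact hmono
  -- assemble: `(2/π)·e^{−2−2C}·(4/π²)·(r/2)³/3 = e^{−2−2C} r³/(3π³)`
  have htot : Real.exp (-2 - 2 * C) * (4 / Real.pi ^ 2) * ((r / 2) ^ 3 / 3) ≤ ∫ θ in (0:ℝ)..Real.pi, F θ := by
    rw [hsplit]; linarith
  have h2π : 0 < 2 / Real.pi := by positivity
  calc Real.exp (-2 - 2 * C) / (3 * Real.pi ^ 3) * β ^ (-(3 / 2 : ℝ))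
        = 2 / Real.pi * (Real.exp (-2 - 2 * C) * (4 / Real.pi ^ 2) * ((r / 2) ^ 3 / 3)) := by
          rw [← hr3]; field_simp; ring
    _ ≤ 2 / Real.pi * ∫ θ in (0:ℝ)..Real.pi, F θ := mul_le_mul_of_nonneg_left htot h2π.le
    _ ≤ _ := hint

/-- **(5.5), lower half, at `ϱ = β^{−α}` with `α ≤ ½`** (then `β^{−1/2} ≤ β^{−α}` for `β ≥ 1`): the hypothesis
`M ≥ mβ^{−3/2}` of the sibling `NonperturbativeBound.eq525`, with `m = e^{−2−2C}/(3π³)`.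
[cite: MullerSchiemann1987, (5.5) p.276; (A₃) p.267] -/
theorem M_lower_bound_rpow {g : Matrix.specialUnitaryGroup (Fin 2) ℂ → ℝ} {β α C : ℝ} (hg : Continuous g)
    (hβ : 1 ≤ β) (hα : α ≤ 1 / 2)
    (hA3 : ∀ v : Matrix.specialUnitaryGroup (Fin 2) ℂ, centralAngle v < β ^ (-α) →
      Real.exp (-(β * centralAngle v ^ 2) - C) ≤ g v) :
    Real.exp (-2 - 2 * C) / (3 * Real.pi ^ 3) * β ^ (-(3 / 2 : ℝ)) ≤
      ∫ v, g v ^ 2 ∂(haarProbability (Matrix.specialUnitaryGroup (Fin 2) ℂ)) :=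
  M_lower_bound hg hβ (Real.rpow_le_rpow_of_exponent_le hβ (by linarith)) hA3

end MLowerBound

end MullerSchiemann1987

end Literature.MathematicalPhysics.QuantumFieldTheory
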